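import Literature.NumberTheory.Sieve.IwaniecAlmostPrimesRootExpSum
import Literature.NumberTheory.Sieve.IwaniecAlmostPrimesQuadraticProp1Corollary
import Literature.NumberTheory.Sieve.IwaniecAlmostPrimesQuadraticFundDomain
import Literature.NumberTheory.Sieve.PolynomialCongruencesRootCount
import Literature.NumberTheory.QuadraticFields.BinaryQuadraticFormsClassNumber
import Mathlib.Data.Nat.Factorization.Induction
import HarnessLib

/-!
# Iwaniec (1978) for a general quadratic `G`: Lemma 4 for `𝒜_G`, I — families, the monic reduction, and the slice estimates

H. Iwaniec, *Almost-primes represented by quadratic polynomials*, Invent. Math. **47** (1978)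
171–188, §4 (Lemma 4 and its proof, pp. 177–181) for the sequence `𝒜_G`, `G = aX² + bX + c`;
R. J. Lemke Oliver, Acta Arith. **151** (2012) 241–261, §3 (Lemma 8 = the general-`G` Lemma 4,
proved by "the theory of quadratic forms, a method originally due to Hooley", pp. 254–259).
Eleventh file of the inline proof of `theorem_quadratic` (`IwaniecAlmostPrimes.lean`); with
`IwaniecAlmostPrimesQuadraticProp1Corollary.lean` the Theorem rests on `proposition1G` (the
dispersion bound for `𝒜_G`), whose one arithmetic input beyond the mean value of `ρ_G` is the
equidistribution of the roots of `G(Ω) ≡ 0 (mod qm)` — Lemma 4 for `G`.  This file sets up the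
general-`G` analogue of `IwaniecAlmostPrimesRootExpSum.lean` up to (and including) the estimate
of one slice of the exponential sum; the passage to form coordinates
(`QuadraticFields/BinaryQuadraticFormsRoots.lean`) and the assembly are the next file.
Everything here is PROVED; no named fact is introduced.

* `card_rootsG` (`#rootsG D = ρ_G(D)` for the tree's `rootsG`), `rootsG_one_zero_one`,
  `lemma4FamilyDvdG` / `lemma4FamilyG` (the pairs `(m, Θ)` of Lemma 4 for `𝒜_G`; `mem_…`,
  `sum_lemma4FamilyDvdG_eq`, `sum_lemma4FamilyG_eq_sum_moebius`; `…_one_zero_one`: for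
  `G = X² + 1` they are the tree's `lemma4FamilyDvd` / `lemma4Family`);
* **the monic reduction** `sum_rootsG_filter_eq` / `sum_rootsG_filter_fourierChar_eq`:
  `Θ ↦ aΘ` is a bijection from the roots of `G` mod `D` in the class `ω (mod d)` onto the roots of
  the MONIC `Y² + bY + ac` mod `aD` in the class `aω (mod ad)`, with `Θ/D = (aΘ)/(aD)` — so the
  non-monic case costs nothing in the exponents (Lemke Oliver's `Γ⁰(f c₂)` and the losses
  `M^{12/13}`, `M^{20/21}` of pp. 258–260 are avoided);
* **counting the admissible classes** (`classCount R s m = #{λ mod m : m ∣ R(s,λ), (λ,(s,m)) = 1}`):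
  `quadratic_resultant_identity` (`4c₂P − (2c₂X+c₁)P' = −disc`),
  `polyRootCountMod_quadratic_prime_pow_le` (`ρ_P(p^k) ≤ 2 disc²` for ANY integral quadratic `P`
  with `disc ≠ 0`, from the tree's resultant bound — no irreducibility needed),
  `classCount_mul_le` (sub-multiplicativity), `classCount_le_polyRootCountMod` (moduli prime to
  `s`: `λ = st`), `classCount_eq_zero_of_dvd` (`p ∣ s`, `p ∤ C`), `classCount_le_prod`
  (`N*(s; m) ≤ ∏_{p∣m} 2Δ²|Δ|^{e p}` when `v_p(m) ≤ e p`);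
* **the slice estimates**: `sq_div_le_slice`, `abs_twistPhaseG_succ_sub_le` (the twist
  `φ(r) = (e₁n + e₂r)/(nP(r))`, `P = c₂r² + c₁nr + c₀n²`, has `|Δφ| ≤ K/n³` on `|r| ≤ n`),
  `norm_sum_Ioo_filter_hooley_mul_le` (Lemma 6 + Abel summation on an interval of length `< 2n`
  against two monotone indicators and a slowly varying weight — the abstract form of the tree's
  `norm_sum_Ioo_pos_le`), `quadP`, `twistQ`, `twistK`, `vertexIdx`, `quadP_le_succ`,
  `quadP_succ_lt`, `norm_piece_le`, and **`norm_sliceSum_le`**: for a modulus `n ≥ 2`,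
  `‖∑_{|r|<n,(r,n)=1, per r, T₁<P(r)≤T₂} e(h' r̄/n) g(r)‖ ≤ #{admissible classes mod Λ} · 3 C n^{1/2+ε} √(h',n)(3 + 4π|h|K/n²)`
  (the range `(−n, n)` is cut at the vertex of `P` and at `0` into three monotone pieces).

The two "regions" of a positive definite form (`|γ| < α` with modulus `α` and the first root
identity, `|α| < γ` with modulus `γ` and the second) are both instances of `norm_sliceSum_le`.

## References

* H. Iwaniec, Invent. Math. 47 (1978) 171–188, §4, Lemmas 4–6 (`IwaniecInventiones1978`).
* R. J. Lemke Oliver, Acta Arith. 151 (2012) 241–261, §3, Lemma 8, (3.5)–(3.12), Lemma 9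
  (`LemkeOliverActaArith2012`).
* C. Hooley, Acta Math. 110 (1963) 97–114 (`Hooley1963`).
-/

open Finset Real Polynomial
open scoped FourierTransform

noncomputable section

namespace Literature.NumberTheory.Sieve.Iwaniec1978

open Literature.NumberTheory.Sieve.Vinogradov (norm_fourierChar)


variable {a b c : ℤ}

/-! ### Roots of `G` modulo `D` (the tree's `rootsG`) -/

/-- `#rootsG D = ρ_G(D)` (`rootsG a b c D` = the roots of `G(Θ) ≡ 0 (mod D)` in `[0, D)`, from
`IwaniecAlmostPrimesQuadraticFundDomain.lean`). [folklore] -/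
theorem card_rootsG (D : ℕ) : (rootsG a b c D).card = rhoG a b c D := by
  rw [rhoG_eq_card_filter_range]
  unfold rootsG
  congr 1
  ext Θ
  simp only [Finset.mem_filter, dvd_gAbs_iff, quadVal]

/-- Consistency with `n² + 1`: `rootsG 1 0 1 = rootsNat`. [folklore] -/
theorem rootsG_one_zero_one (D : ℕ) : rootsG 1 0 1 D = rootsNat D := by
  ext Θ
  rw [mem_rootsG, mem_rootsNat]
  simp only [quadVal, one_mul, zero_mul, add_zero]
  exact and_congr_right fun _ => by exact_mod_cast Iff.rfl

/-! ### The families of pairs `(m, Θ)` of Lemma 4 for `𝒜_G` -/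

/-- The pairs `(m, Θ)` of Lemma 4 for `G` with the coprimality condition replaced by `l ∣ m`:
`A < m ≤ B`, `l ∣ m`, `m ≡ μ (mod d)`, `0 ≤ Θ < mq` a root of `G(Θ) ≡ 0 (mod mq)`, `Θ ≡ ω (mod d)`
(Lemke Oliver, Lemma 4 / (3.5) after Möbius inversion, p. 255). [cite: LemkeOliverActaArith2012, Lemma 4] -/
def lemma4FamilyDvdG (a b c : ℤ) (q l d μ ω A B : ℕ) : Finset (ℕ × ℕ) :=
  (Finset.Ioc A B ×ˢ Finset.range (B * q)).filter (fun p =>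
    l ∣ p.1 ∧ p.1 ≡ μ [MOD d] ∧ p.2 < p.1 * q ∧
      ((p.1 * q : ℕ) : ℤ) ∣ a * (p.2 : ℤ) ^ 2 + b * p.2 + c ∧ p.2 ≡ ω [MOD d])

/-- Membership in `lemma4FamilyDvdG`. [folklore] -/
theorem mem_lemma4FamilyDvdG {q l d μ ω A B : ℕ} {p : ℕ × ℕ} :
    p ∈ lemma4FamilyDvdG a b c q l d μ ω A B ↔ (A < p.1 ∧ p.1 ≤ B) ∧ l ∣ p.1 ∧ p.1 ≡ μ [MOD d] ∧
      p.2 ∈ rootsG a b c (p.1 * q) ∧ p.2 ≡ ω [MOD d] := by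
  simp only [lemma4FamilyDvdG, Finset.mem_filter, Finset.mem_product, Finset.mem_Ioc,
    Finset.mem_range, mem_rootsG, quadVal]
  constructor
  · rintro ⟨⟨h1, -⟩, h2, h3, h4, h5, h6⟩
    exact ⟨h1, h2, h3, ⟨h4, h5⟩, h6⟩
  · rintro ⟨h1, h2, h3, ⟨h4, h5⟩, h6⟩
    refine ⟨⟨h1, ?_⟩, h2, h3, h4, h5, h6⟩
    calc p.2 < p.1 * q := h4
      _ ≤ B * q := Nat.mul_le_mul_right q h1.2

/-- The family as an iterated sum over `m` and then `Θ`. [folklore] -/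
theorem sum_lemma4FamilyDvdG_eq {q l d μ ω A B : ℕ} (F : ℕ × ℕ → ℂ) :
    ∑ p ∈ lemma4FamilyDvdG a b c q l d μ ω A B, F p =
      ∑ m ∈ (Finset.Ioc A B).filter (fun m => l ∣ m ∧ m ≡ μ [MOD d]),
        ∑ Θ ∈ (rootsG a b c (m * q)).filter (fun Θ => Θ ≡ ω [MOD d]), F (m, Θ) := by
  classical
  have hfam : lemma4FamilyDvdG a b c q l d μ ω A B =
      ((Finset.Ioc A B).filter (fun m => l ∣ m ∧ m ≡ μ [MOD d])).biUnion
        (fun m => ((rootsG a b c (m * q)).filter (fun Θ => Θ ≡ ω [MOD d])).image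
          (fun Θ => (m, Θ))) := by
    ext p
    rw [mem_lemma4FamilyDvdG, Finset.mem_biUnion]
    constructor
    · rintro ⟨h1, h2, h3, h4, h5⟩
      refine ⟨p.1, ?_, ?_⟩
      · rw [Finset.mem_filter, Finset.mem_Ioc]; exact ⟨h1, h2, h3⟩
      · rw [Finset.mem_image]; exact ⟨p.2, Finset.mem_filter.mpr ⟨h4, h5⟩, rfl⟩
    · rintro ⟨m, hm, hp⟩
      rw [Finset.mem_filter, Finset.mem_Ioc] at hm
      rw [Finset.mem_image] at hp
      obtain ⟨Θ, hΘ, rfl⟩ := hp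
      rw [Finset.mem_filter] at hΘ
      exact ⟨hm.1, hm.2.1, hm.2.2, hΘ.1, hΘ.2⟩
  rw [hfam, Finset.sum_biUnion]
  · refine Finset.sum_congr rfl fun m _ => ?_
    rw [Finset.sum_image]
    intro x _ y _ h
    exact (Prod.mk.inj h).2
  · intro m _ m' _ hne
    simp only [Function.onFun]
    rw [Finset.disjoint_left]
    intro p hp hp'
    rw [Finset.mem_image] at hp hp'
    obtain ⟨Θ, _, rfl⟩ := hp
    obtain ⟨Θ', _, h⟩ := hp'
    exact hne (Prod.mk.inj h).1.symm

/-- The pairs `(m, Θ)` of Lemma 4 for `G`: `A < m ≤ B`, `(m, Q) = 1`, `m ≡ μ (mod d)`,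
`0 ≤ Θ < mq` a root of `G(Θ) ≡ 0 (mod mq)`, `Θ ≡ ω (mod d)` (Lemke Oliver, Lemma 4 = Lemma 8;
Iwaniec's Lemma 4 for `𝒜_G`). [cite: LemkeOliverActaArith2012, Lemma 4] -/
def lemma4FamilyG (a b c : ℤ) (q Q d μ ω A B : ℕ) : Finset (ℕ × ℕ) :=
  (lemma4FamilyDvdG a b c q 1 d μ ω A B).filter (fun p => p.1.Coprime Q)

/-- Membership in `lemma4FamilyG`. [folklore] -/
theorem mem_lemma4FamilyG {q Q d μ ω A B : ℕ} {p : ℕ × ℕ} :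
    p ∈ lemma4FamilyG a b c q Q d μ ω A B ↔ (A < p.1 ∧ p.1 ≤ B) ∧ p.1.Coprime Q ∧
      p.1 ≡ μ [MOD d] ∧ p.2 ∈ rootsG a b c (p.1 * q) ∧ p.2 ≡ ω [MOD d] := by
  rw [lemma4FamilyG, Finset.mem_filter, mem_lemma4FamilyDvdG]
  simp only [one_dvd, true_and]
  tauto

/-- `∑_{family} F = ∑_{l ∣ Q} μ(l) ∑_{family with l ∣ m} F`. [folklore] -/
theorem sum_lemma4FamilyG_eq_sum_moebius {q Q d μ ω A B : ℕ} (hQ : Q ≠ 0) (F : ℕ × ℕ → ℂ) :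
    ∑ p ∈ lemma4FamilyG a b c q Q d μ ω A B, F p =
      ∑ l ∈ Q.divisors, (ArithmeticFunction.moebius l : ℂ) *
        ∑ p ∈ lemma4FamilyDvdG a b c q l d μ ω A B, F p := by
  classical
  rw [lemma4FamilyG, Finset.sum_filter]
  have h1 : ∀ p ∈ lemma4FamilyDvdG a b c q 1 d μ ω A B, (if p.1.Coprime Q then F p else 0) =
      ∑ l ∈ Q.divisors, (ArithmeticFunction.moebius l : ℂ) * (if l ∣ p.1 then F p else 0) := by
    intro p hp
    rw [mem_lemma4FamilyDvdG] at hp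
    have hm : p.1 ≠ 0 := by have := hp.1.1; omega
    have := ite_coprime_eq_sum_moebius_ite hm hQ
    calc (if p.1.Coprime Q then F p else 0) = (if p.1.Coprime Q then (1 : ℂ) else 0) * F p := by
          split_ifs <;> simp
      _ = ∑ l ∈ Q.divisors, (ArithmeticFunction.moebius l : ℂ) * (if l ∣ p.1 then 1 else 0) * F p := by
          rw [this, Finset.sum_mul]
      _ = _ := Finset.sum_congr rfl fun l _ => by split_ifs <;> simp
  rw [Finset.sum_congr rfl h1, Finset.sum_comm]
  refine Finset.sum_congr rfl fun l _ => ?_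
  rw [← Finset.mul_sum, ← Finset.sum_filter]
  congr 1
  apply Finset.sum_congr _ (fun _ _ => rfl)
  ext p
  rw [Finset.mem_filter, mem_lemma4FamilyDvdG, mem_lemma4FamilyDvdG]
  simp only [one_dvd, true_and]
  tauto

/-- Consistency with `n² + 1`: the `G = X² + 1` families are the tree's. [folklore] -/
theorem lemma4FamilyDvdG_one_zero_one (q l d μ ω A B : ℕ) :
    lemma4FamilyDvdG 1 0 1 q l d μ ω A B = lemma4FamilyDvd q l d μ ω A B := by
  ext p
  rw [mem_lemma4FamilyDvdG, mem_lemma4FamilyDvd, rootsG_one_zero_one]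

/-- Consistency with `n² + 1`: `lemma4FamilyG 1 0 1 = lemma4Family`. [folklore] -/
theorem lemma4FamilyG_one_zero_one (q Q d μ ω A B : ℕ) :
    lemma4FamilyG 1 0 1 q Q d μ ω A B = lemma4Family q Q d μ ω A B := by
  rw [lemma4FamilyG, lemma4FamilyDvdG_one_zero_one]; rfl

/-! ### The monic reduction: roots of `G` mod `D` are the roots of `Y² + bY + ac` mod `aD` divisible by `a` -/

/-- `a·G(Θ) = H(aΘ)` with `H(Y) = Y² + bY + ac`. [folklore] -/
theorem mul_quad_eq (a b c Θ : ℤ) :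
    a * (a * Θ ^ 2 + b * Θ + c) = (a * Θ) ^ 2 + b * (a * Θ) + a * c := by ring

/-- **The monic reduction** (for `a > 0`): `Θ ↦ aΘ` is a bijection from the roots
`0 ≤ Θ < D` of `G(Θ) ≡ 0 (mod D)` with `Θ ≡ ω (mod d)` onto the roots `0 ≤ M < aD` of
`M² + bM + ac ≡ 0 (mod aD)` with `M ≡ aω (mod ad)`, and `Θ/D = M/(aD)`.  So every root sum for `G`
is a root sum for the MONIC `Y² + bY + ac` (same discriminant `b² − 4ac`) to the modulus `aD`,
with a root class modulo `ad`. [folklore] -/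
theorem sum_rootsG_filter_eq (ha : 0 < a) (D d ω : ℕ) (F : ℕ → ℂ) :
    ∑ Θ ∈ (rootsG a b c D).filter (fun Θ => Θ ≡ ω [MOD d]), F Θ =
      ∑ M ∈ ((Finset.range (a.toNat * D)).filter (fun M : ℕ =>
          ((a.toNat * D : ℕ) : ℤ) ∣ (M : ℤ) ^ 2 + b * M + a * c)).filter
            (fun M => M ≡ a.toNat * ω [MOD a.toNat * d]), F (M / a.toNat) := by
  set A := a.toNat with hA
  have hAa : (A : ℤ) = a := Int.toNat_of_nonneg ha.le
  have hA0 : 0 < A := by omega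
  refine Finset.sum_nbij (fun Θ => A * Θ) ?_ ?_ ?_ ?_
  · intro Θ hΘ
    rw [Finset.mem_filter, mem_rootsG] at hΘ
    obtain ⟨⟨hΘD, hdvd⟩, hmod⟩ := hΘ
    dsimp only [quadVal] at hdvd
    rw [Finset.mem_filter, Finset.mem_filter, Finset.mem_range]
    refine ⟨⟨Nat.mul_lt_mul_of_pos_left hΘD hA0, ?_⟩, Nat.ModEq.mul_left' A hmod⟩
    push_cast
    rw [hAa, ← mul_quad_eq]
    exact mul_dvd_mul_left a hdvd
  · intro Θ _ Θ' _ h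
    exact Nat.eq_of_mul_eq_mul_left hA0 h
  · intro M hM
    rw [Finset.mem_coe, Finset.mem_filter, Finset.mem_filter, Finset.mem_range] at hM
    obtain ⟨⟨hMD, hdvd⟩, hmod⟩ := hM
    have hAM : A ∣ M := by
      have h1 : M ≡ A * ω [MOD A] := Nat.ModEq.of_mul_right d hmod
      have h2 : A * ω ≡ 0 [MOD A] := Nat.modEq_zero_iff_dvd.2 (dvd_mul_right A ω)
      exact Nat.modEq_zero_iff_dvd.1 (h1.trans h2)
    obtain ⟨Θ, rfl⟩ := hAM
    refine ⟨Θ, ?_, rfl⟩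
    rw [Finset.mem_coe, Finset.mem_filter, mem_rootsG]
    dsimp only [quadVal]
    refine ⟨⟨Nat.lt_of_mul_lt_mul_left hMD, ?_⟩, Nat.ModEq.mul_left_cancel' hA0.ne' hmod⟩
    push_cast at hdvd
    rw [hAa, ← mul_quad_eq] at hdvd
    exact (mul_dvd_mul_iff_left ha.ne').1 hdvd
  · intro Θ _
    simp only [Nat.mul_div_cancel_left Θ hA0]

/-- The exponential-sum form of the monic reduction for the modulus `mq`:
`∑_{Θ root of G mod mq, Θ ≡ ω (d)} e(hΘ/(mq)) = ∑_{M root of Y²+bY+ac mod amq, M ≡ aω (ad)} e(hM/(amq))`.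
[folklore] -/
theorem sum_rootsG_filter_fourierChar_eq (ha : 0 < a) (D d ω : ℕ) (h : ℤ) :
    ∑ Θ ∈ (rootsG a b c D).filter (fun Θ => Θ ≡ ω [MOD d]), (𝐞 ((h : ℝ) * Θ / D) : ℂ) =
      ∑ M ∈ ((Finset.range (a.toNat * D)).filter (fun M : ℕ =>
          ((a.toNat * D : ℕ) : ℤ) ∣ (M : ℤ) ^ 2 + b * M + a * c)).filter
            (fun M => M ≡ a.toNat * ω [MOD a.toNat * d]),
        (𝐞 ((h : ℝ) * M / ((a.toNat * D : ℕ) : ℝ)) : ℂ) := by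
  rw [sum_rootsG_filter_eq ha D d ω (fun Θ : ℕ => (𝐞 ((h : ℝ) * Θ / D) : ℂ))]
  refine Finset.sum_congr rfl fun M hM => ?_
  rw [Finset.mem_filter] at hM
  set A := a.toNat with hA
  have hA0 : 0 < A := by omega
  have hAM : A ∣ M := by
    have h1 : M ≡ A * ω [MOD A] := Nat.ModEq.of_mul_right d hM.2
    have h2 : A * ω ≡ 0 [MOD A] := Nat.modEq_zero_iff_dvd.2 (dvd_mul_right A ω)
    exact Nat.modEq_zero_iff_dvd.1 (h1.trans h2)
  obtain ⟨Θ, rfl⟩ := hAM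
  congr 1
  rw [Nat.mul_div_cancel_left Θ hA0]
  have hA0' : (A : ℝ) ≠ 0 := by exact_mod_cast hA0.ne'
  push_cast
  field_simp




open Literature.NumberTheory.QuadraticFields.Quadratic

/-! ### Roots of an integral quadratic modulo prime powers: a uniform bound from the resultant -/

/-- `4c₂·P − (2c₂X + c₁)·P' = 4c₀c₂ − c₁²` for `P = c₂X² + c₁X + c₀`. [folklore] -/
theorem quadratic_resultant_identity (c₀ c₁ c₂ : ℤ) :
    (C c₂ * X ^ 2 + C c₁ * X + C c₀) * C (4 * c₂) +
        derivative (C c₂ * X ^ 2 + C c₁ * X + C c₀) * (-(C (2 * c₂) * X + C c₁)) =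
      C (4 * c₀ * c₂ - c₁ ^ 2) := by
  have hd : derivative (C c₂ * X ^ 2 + C c₁ * X + C c₀) = C (c₂ * 2) * X + C c₁ := by
    rw [derivative_add, derivative_add, derivative_C_mul_X_pow, derivative_C_mul_X, derivative_C,
      add_zero]
    norm_num
  rw [hd]
  simp only [map_mul, map_sub, map_pow, map_ofNat]
  ring

/-- **A uniform bound for the roots of a quadratic modulo prime powers**: if
`Δ = c₁² − 4c₀c₂ ≠ 0` then `#{t mod p^k : p^k ∣ c₂t² + c₁t + c₀} ≤ 2Δ²` for every prime `p` and
every `k` (the tree's resultant bound `polyRootCountMod_prime_pow_le_of_resultant` with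
`R = −Δ` for `k > 2v_p(Δ)`, the trivial bound `≤ p^k ≤ Δ²` otherwise). [folklore] -/
theorem polyRootCountMod_quadratic_prime_pow_le {c₀ c₁ c₂ : ℤ} (hΔ : c₁ ^ 2 - 4 * c₀ * c₂ ≠ 0)
    {p : ℕ} (hp : p.Prime) (k : ℕ) :
    polyRootCountMod ![C c₂ * X ^ 2 + C c₁ * X + C c₀] (p ^ k) ≤
      2 * (c₁ ^ 2 - 4 * c₀ * c₂).natAbs ^ 2 := by
  haveI := Fact.mk hp
  set R : ℤ := 4 * c₀ * c₂ - c₁ ^ 2 with hR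
  have hR0 : R ≠ 0 := by rw [hR]; intro h; apply hΔ; linarith
  have hRabs : R.natAbs = (c₁ ^ 2 - 4 * c₀ * c₂).natAbs := by
    rw [hR, ← Int.natAbs_neg]; congr 1; ring
  set δ := padicValInt p R with hδ
  have hpδ : p ^ δ ≤ R.natAbs :=
    Nat.le_of_dvd (Int.natAbs_pos.2 hR0) pow_padicValNat_dvd
  have hR1 : 1 ≤ R.natAbs := Int.natAbs_pos.2 hR0
  rw [← hRabs]
  rcases lt_or_ge k (2 * δ + 1) with hk | hk
  · have h1 : polyRootCountMod ![C c₂ * X ^ 2 + C c₁ * X + C c₀] (p ^ k) ≤ R.natAbs ^ 2 :=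
      calc polyRootCountMod ![C c₂ * X ^ 2 + C c₁ * X + C c₀] (p ^ k) ≤ p ^ k :=
            polyRootCountMod_le _ _
        _ ≤ p ^ (2 * δ) := Nat.pow_le_pow_right hp.pos (by omega)
        _ = (p ^ δ) ^ 2 := by ring
        _ ≤ R.natAbs ^ 2 := Nat.pow_le_pow_left hpδ 2
    omega
  · have hres := polyRootCountMod_prime_pow_le_of_resultant (p := p) hR0
      (quadratic_resultant_identity c₀ c₁ c₂) hk
    have hdeg : (C c₂ * X ^ 2 + C c₁ * X + C c₀).natDegree ≤ 2 := natDegree_quadratic_le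
    have h1 : polyRootCountMod ![C c₂ * X ^ 2 + C c₁ * X + C c₀] (p ^ k) ≤ 2 * R.natAbs :=
      hres.trans (Nat.mul_le_mul hdeg hpδ)
    nlinarith

/-! ### The admissible classes `λ mod m`: `m ∣ R(s, λ)`, `λ` prime to `(s, m)` -/

/-- `N*(s; m) = #{λ mod m : m ∣ R(s, λ), (λ, (s, m)) = 1}` — the residue classes of the running
variable that can carry terms of the slice `s` (the coprimality `(λ, s) = 1` of a proper
representation is remembered modulo `m`). [cite: LemkeOliverActaArith2012, §3 (3.9)] -/
def classCount (R : BinQF) (s : ℤ) (m : ℕ) : ℕ :=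
  ((Finset.range m).filter (fun lam : ℕ =>
    (m : ℤ) ∣ R.eval s lam ∧ Nat.Coprime lam (Nat.gcd s.natAbs m))).card

/-- `N*(s; m) ≤ m`. [folklore] -/
theorem classCount_le (R : BinQF) (s : ℤ) (m : ℕ) : classCount R s m ≤ m :=
  (Finset.card_filter_le _ _).trans (Finset.card_range m).le

/-- `R(s, ·)` respects congruences. [folklore] -/
theorem eval_modEq_of_modEq_snd (R : BinQF) (s : ℤ) {n x y : ℤ} (h : x ≡ y [ZMOD n]) :
    R.eval s x ≡ R.eval s y [ZMOD n] := by
  unfold BinQF.eval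
  exact ((Int.ModEq.refl (R.a * s ^ 2)).add (h.mul_left (R.b * s))).add ((h.pow 2).mul_left R.c)

/-- **Sub-multiplicativity**: `N*(s; m₁m₂) ≤ N*(s; m₁) N*(s; m₂)` for coprime `m₁, m₂`
(`λ ↦ (λ mod m₁, λ mod m₂)` is injective). [folklore] -/
theorem classCount_mul_le (R : BinQF) (s : ℤ) {m₁ m₂ : ℕ} (hm₁ : 0 < m₁) (hm₂ : 0 < m₂)
    (hc : m₁.Coprime m₂) :
    classCount R s (m₁ * m₂) ≤ classCount R s m₁ * classCount R s m₂ := by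
  classical
  unfold classCount
  set S₁ := (Finset.range m₁).filter (fun lam : ℕ =>
    (m₁ : ℤ) ∣ R.eval s lam ∧ Nat.Coprime lam (Nat.gcd s.natAbs m₁)) with hS₁
  set S₂ := (Finset.range m₂).filter (fun lam : ℕ =>
    (m₂ : ℤ) ∣ R.eval s lam ∧ Nat.Coprime lam (Nat.gcd s.natAbs m₂)) with hS₂
  rw [← Finset.card_product]
  refine Finset.card_le_card_of_injOn (fun lam => (lam % m₁, lam % m₂)) ?_ ?_
  · intro lam hlam
    rw [Finset.mem_coe, Finset.mem_filter, Finset.mem_range] at hlam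
    obtain ⟨hlt, hdvd, hcop⟩ := hlam
    have hproj : ∀ {m : ℕ}, 0 < m → (m : ℤ) ∣ ((m₁ * m₂ : ℕ) : ℤ) → m ∣ m₁ * m₂ →
        lam % m ∈ (Finset.range m).filter (fun mu : ℕ =>
          (m : ℤ) ∣ R.eval s mu ∧ Nat.Coprime mu (Nat.gcd s.natAbs m)) := by
      intro m hm hmz hmn
      rw [Finset.mem_filter, Finset.mem_range]
      refine ⟨Nat.mod_lt _ hm, ?_, ?_⟩
      · have h1 : (m : ℤ) ∣ R.eval s lam := hmz.trans hdvd
        have h2 : ((lam % m : ℕ) : ℤ) ≡ (lam : ℤ) [ZMOD m] := by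
          rw [Int.natCast_mod]; exact Int.mod_modEq _ _
        exact (Int.ModEq.dvd_iff (eval_modEq_of_modEq_snd R s h2)).2 h1
      · have hg : Nat.gcd s.natAbs m ∣ Nat.gcd s.natAbs (m₁ * m₂) :=
          Nat.gcd_dvd_gcd_of_dvd_right _ hmn
        have h3 : Nat.Coprime lam (Nat.gcd s.natAbs m) := Nat.Coprime.coprime_dvd_right hg hcop
        have h4 : lam % m ≡ lam [MOD Nat.gcd s.natAbs m] :=
          Nat.ModEq.of_dvd (Nat.gcd_dvd_right _ _) (Nat.mod_modEq lam m)
        rw [Nat.Coprime, h4.gcd_eq]; exact h3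
    rw [Finset.mem_coe, Finset.mem_product]
    exact ⟨hproj hm₁ (by exact_mod_cast dvd_mul_right m₁ m₂) (dvd_mul_right m₁ m₂),
      hproj hm₂ (by exact_mod_cast dvd_mul_left m₂ m₁) (dvd_mul_left m₂ m₁)⟩
  · intro x hx y hy hxy
    rw [Finset.mem_coe, Finset.mem_filter, Finset.mem_range] at hx hy
    simp only [Prod.mk.injEq] at hxy
    have h1 : x ≡ y [MOD m₁] := hxy.1
    have h2 : x ≡ y [MOD m₂] := hxy.2
    have h12 : x ≡ y [MOD m₁ * m₂] := (Nat.modEq_and_modEq_iff_modEq_mul hc).1 ⟨h1, h2⟩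
    exact Nat.ModEq.eq_of_lt_of_lt h12 hx.1 hy.1

/-- **Moduli prime to `s`**: `N*(s; m) ≤ ρ_P(m)` with `P(t) = Ct² + Bt + A = R(1, t)`
(substitute `λ = s t`). [folklore] -/
theorem classCount_le_polyRootCountMod (R : BinQF) {s : ℤ} {m : ℕ} (hm : 0 < m)
    (hsm : Int.gcd s m = 1) :
    classCount R s m ≤ polyRootCountMod ![C R.c * X ^ 2 + C R.b * X + C R.a] m := by
  classical
  obtain ⟨u, w, huw⟩ := Int.isCoprime_iff_gcd_eq_one.2 hsm
  -- `u` is an inverse of `s` modulo `m`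
  have hm0 : (0 : ℤ) < m := by exact_mod_cast hm
  unfold classCount polyRootCountMod
  refine Finset.card_le_card_of_injOn (fun lam : ℕ => (((lam : ℤ) * u) % m).toNat) ?_ ?_
  · intro lam hlam
    rw [Finset.mem_coe, Finset.mem_filter, Finset.mem_range] at hlam
    obtain ⟨hlt, hdvd, -⟩ := hlam
    have h0 : 0 ≤ ((lam : ℤ) * u) % m := Int.emod_nonneg _ hm0.ne'
    have hcast : (((((lam : ℤ) * u) % m).toNat : ℕ) : ℤ) = ((lam : ℤ) * u) % m :=
      Int.toNat_of_nonneg h0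
    rw [Finset.mem_coe, Finset.mem_filter, Finset.mem_range]
    constructor
    · have : (((((lam : ℤ) * u) % m).toNat : ℕ) : ℤ) < m := by
        rw [hcast]; exact Int.emod_lt_of_pos _ hm0
      exact_mod_cast this
    · simp only [Fin.prod_univ_one, Matrix.cons_val_fin_one, eval_add, eval_mul, eval_C,
        eval_pow, eval_X]
      rw [hcast]
      set t : ℤ := (lam : ℤ) * u with ht
      have hmod : t % m ≡ t [ZMOD m] := Int.mod_modEq _ _
      have hP : R.c * (t % ↑m) ^ 2 + R.b * (t % ↑m) + R.a ≡ R.c * t ^ 2 + R.b * t + R.a [ZMOD m] :=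
        (((hmod.pow 2).mul_left _).add (hmod.mul_left _)).add_right _
      refine (Int.ModEq.dvd_iff hP).2 ?_
      -- `s² P(t) ≡ R(s, λ) (mod m)`
      have hsu : s * u ≡ 1 [ZMOD m] := Int.modEq_iff_dvd.2 ⟨w, by linear_combination -huw⟩
      have hkey : s ^ 2 * (R.c * t ^ 2 + R.b * t + R.a) ≡ R.eval s lam [ZMOD m] := by
        have e1 : s ^ 2 * (R.c * t ^ 2 + R.b * t + R.a) =
            R.a * s ^ 2 + R.b * s * lam * (s * u) + R.c * lam ^ 2 * (s * u) ^ 2 := by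
          rw [ht]; ring
        have e2 : R.eval s lam = R.a * s ^ 2 + R.b * s * lam * 1 + R.c * lam ^ 2 * 1 ^ 2 := by
          unfold BinQF.eval; ring
        rw [e1, e2]
        exact ((Int.ModEq.refl _).add (hsu.mul_left _)).add ((hsu.pow 2).mul_left _)
      have h1 : (m : ℤ) ∣ s ^ 2 * (R.c * t ^ 2 + R.b * t + R.a) := (Int.ModEq.dvd_iff hkey).2 hdvd
      have hcop : IsCoprime (m : ℤ) (s ^ 2) := (Int.isCoprime_iff_gcd_eq_one.2 hsm).pow_left.symm
      exact hcop.dvd_of_dvd_mul_left h1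
  · intro x hx y hy hxy
    rw [Finset.mem_coe, Finset.mem_filter, Finset.mem_range] at hx hy
    simp only at hxy
    have h0x : 0 ≤ ((x : ℤ) * u) % m := Int.emod_nonneg _ hm0.ne'
    have h0y : 0 ≤ ((y : ℤ) * u) % m := Int.emod_nonneg _ hm0.ne'
    have hxy' : ((x : ℤ) * u) % m = ((y : ℤ) * u) % m := by
      have := congrArg (fun n : ℕ => (n : ℤ)) hxy
      simpa only [Int.toNat_of_nonneg h0x, Int.toNat_of_nonneg h0y] using this
    have hmod : (x : ℤ) * u ≡ (y : ℤ) * u [ZMOD m] := hxy'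
    have hsu : s * u ≡ 1 [ZMOD m] := Int.modEq_iff_dvd.2 ⟨w, by linear_combination -huw⟩
    have hx1 : (x : ℤ) * u * s ≡ x [ZMOD m] := by
      have := hsu.mul_left (x : ℤ); rw [mul_one] at this
      simpa [mul_comm, mul_assoc, mul_left_comm] using this
    have hy1 : (y : ℤ) * u * s ≡ y [ZMOD m] := by
      have := hsu.mul_left (y : ℤ); rw [mul_one] at this
      simpa [mul_comm, mul_assoc, mul_left_comm] using this
    have hxy2 : (x : ℤ) ≡ y [ZMOD m] := (hx1.symm.trans (hmod.mul_right s)).trans hy1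
    have hxy3 : x ≡ y [MOD m] := Int.natCast_modEq_iff.1 hxy2
    exact Nat.ModEq.eq_of_lt_of_lt hxy3 hx.1 hy.1

/-- **Prime powers dividing `s`**: the slice is empty modulo `p` unless `p ∣ C`
(`R(s, λ) ≡ Cλ² (mod p)` and `p ∤ λ`). [folklore] -/
theorem classCount_eq_zero_of_dvd (R : BinQF) {s : ℤ} {p : ℕ} (hp : p.Prime) {k : ℕ}
    (hk : 0 < k) (hps : (p : ℤ) ∣ s) (hpc : ¬ (p : ℤ) ∣ R.c) : classCount R s (p ^ k) = 0 := by
  classical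
  unfold classCount
  rw [Finset.card_eq_zero, Finset.filter_eq_empty_iff]
  intro lam _ ⟨hdvd, hcop⟩
  have hp1 : (p : ℤ) ∣ ((p ^ k : ℕ) : ℤ) := by
    exact_mod_cast dvd_pow_self p hk.ne'
  have h1 : (p : ℤ) ∣ R.eval s lam := hp1.trans hdvd
  have h2 : (p : ℤ) ∣ R.c * (lam : ℤ) ^ 2 := by
    have : R.eval s lam = s * (R.a * s + R.b * lam) + R.c * (lam : ℤ) ^ 2 := by
      unfold BinQF.eval; ring
    rw [this] at h1
    exact (dvd_add_right (hps.mul_right _)).1 h1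
  have hpl : ¬ (p : ℤ) ∣ (lam : ℤ) := by
    intro h
    have h3 : p ∣ lam := Int.natCast_dvd_natCast.1 h
    have h4 : p ∣ Nat.gcd s.natAbs (p ^ k) :=
      Nat.dvd_gcd (Int.natCast_dvd.1 hps) (dvd_pow_self p hk.ne')
    have h5 : p ∣ Nat.gcd lam (Nat.gcd s.natAbs (p ^ k)) := Nat.dvd_gcd h3 h4
    rw [hcop] at h5
    exact hp.one_lt.ne' (Nat.dvd_one.1 h5)
  have hprime : Prime (p : ℤ) := Nat.prime_iff_prime_int.1 hp
  rcases hprime.dvd_or_dvd h2 with h | h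
  · exact hpc h
  · exact hpl (hprime.dvd_of_dvd_pow h)

/-- **The class count is bounded multiplicatively**: if every prime-power exponent of `m` is at
most `e p` then
`N*(s; m) ≤ ∏_{p ∣ m} 2Δ² |Δ|^{e p}`, `Δ = disc R` (per prime: `≤ 2Δ²` if `p ∤ s` by
`polyRootCountMod_quadratic_prime_pow_le`, `≤ p^{e p} ≤ |Δ|^{e p}` if `p ∣ s`, since then `p ∣ C`
or the count vanishes). [folklore] -/
theorem classCount_le_prod (R : BinQF) (hΔ : R.disc ≠ 0) (hc : R.c ≠ 0)
    (hCΔ : R.c.natAbs ≤ R.disc.natAbs) (s : ℤ) (e : ℕ → ℕ) :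
    ∀ m : ℕ, (∀ p : ℕ, p.Prime → m.factorization p ≤ e p) →
      classCount R s m ≤ ∏ p ∈ m.primeFactors, 2 * R.disc.natAbs ^ 2 * R.disc.natAbs ^ e p := by
  have hD1 : 1 ≤ R.disc.natAbs := Int.natAbs_pos.2 hΔ
  have hB1 : ∀ p, 1 ≤ 2 * R.disc.natAbs ^ 2 * R.disc.natAbs ^ e p := fun p => by
    have : 1 ≤ R.disc.natAbs ^ 2 := Nat.one_le_pow _ _ hD1
    have : 1 ≤ R.disc.natAbs ^ e p := Nat.one_le_pow _ _ hD1
    nlinarith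
  intro m
  induction m using Nat.recOnPosPrimePosCoprime with
  | zero => intro _; simp [classCount]
  | one =>
    intro _
    simp only [Nat.primeFactors_one, Finset.prod_empty]
    exact classCount_le R s 1
  | prime_pow p k hp hk =>
    intro hfac
    have hpp : p.Prime := hp
    rw [Nat.primeFactors_prime_pow hk.ne' hpp, Finset.prod_singleton]
    have hkp : k ≤ e p := by
      have := hfac p hpp
      rwa [Nat.Prime.factorization_pow hpp, Finsupp.single_eq_same] at this
    by_cases hps : (p : ℤ) ∣ s
    · by_cases hpc : (p : ℤ) ∣ R.c
      · -- `p ≤ |C| ≤ |Δ|`, so `N* ≤ p^k ≤ |Δ|^k ≤ |Δ|^{e p}`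
        have hpC : p ≤ R.c.natAbs := Nat.le_of_dvd (Int.natAbs_pos.2 hc) (Int.natCast_dvd.1 hpc)
        calc classCount R s (p ^ k) ≤ p ^ k := classCount_le _ _ _
          _ ≤ R.disc.natAbs ^ k := Nat.pow_le_pow_left (hpC.trans hCΔ) k
          _ ≤ R.disc.natAbs ^ e p := Nat.pow_le_pow_right hD1 hkp
          _ ≤ 2 * R.disc.natAbs ^ 2 * R.disc.natAbs ^ e p :=
              Nat.le_mul_of_pos_left _ (by positivity)
      · rw [classCount_eq_zero_of_dvd R hpp hk hps hpc]
        exact Nat.zero_le _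
    · have hcop : Int.gcd s (p ^ k : ℕ) = 1 := by
        have : Nat.Coprime s.natAbs (p ^ k) :=
          Nat.Coprime.pow_right k
            ((Nat.Prime.coprime_iff_not_dvd hpp).2 (fun h => hps (Int.natCast_dvd.2 h))).symm
        show Nat.gcd s.natAbs ((p ^ k : ℕ) : ℤ).natAbs = 1
        rw [Int.natAbs_natCast]; exact this
      have hdisc : R.b ^ 2 - 4 * R.a * R.c ≠ 0 := hΔ
      calc classCount R s (p ^ k)
          ≤ polyRootCountMod ![C R.c * X ^ 2 + C R.b * X + C R.a] (p ^ k) :=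
            classCount_le_polyRootCountMod R (pow_pos hpp.pos k) hcop
        _ ≤ 2 * (R.b ^ 2 - 4 * R.a * R.c).natAbs ^ 2 :=
            polyRootCountMod_quadratic_prime_pow_le (by
              intro h; apply hdisc; linarith) hpp k
        _ = 2 * R.disc.natAbs ^ 2 := rfl
        _ ≤ 2 * R.disc.natAbs ^ 2 * R.disc.natAbs ^ e p :=
            Nat.le_mul_of_pos_right _ (Nat.one_le_pow _ _ hD1)
  | coprime m₁ m₂ hm₁ hm₂ hcop ih₁ ih₂ =>
    intro hfac
    have hm₁0 : m₁ ≠ 0 := by omega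
    have hm₂0 : m₂ ≠ 0 := by omega
    have hf₁ : ∀ p : ℕ, p.Prime → m₁.factorization p ≤ e p := fun p hp =>
      le_trans (by rw [Nat.factorization_mul hm₁0 hm₂0]; simp) (hfac p hp)
    have hf₂ : ∀ p : ℕ, p.Prime → m₂.factorization p ≤ e p := fun p hp =>
      le_trans (by rw [Nat.factorization_mul hm₁0 hm₂0]; simp) (hfac p hp)
    rw [Nat.primeFactors_mul hm₁0 hm₂0, Finset.prod_union hcop.disjoint_primeFactors]
    calc classCount R s (m₁ * m₂) ≤ classCount R s m₁ * classCount R s m₂ :=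
          classCount_mul_le R s (by omega) (by omega) hcop
      _ ≤ _ := Nat.mul_le_mul (ih₁ hf₁) (ih₂ hf₂)




/-- A positive definite slice is bounded below: `n²/(4c₂) ≤ c₂r² + c₁nr + c₀n²` when
`4c₀c₂ − c₁² ≥ 1`, `c₂ > 0`. [folklore] -/
theorem sq_div_le_slice {c₀ c₁ c₂ n : ℝ} (hc₂ : 0 < c₂) (hD : 1 ≤ 4 * c₀ * c₂ - c₁ ^ 2) (r : ℝ) :
    n ^ 2 / (4 * c₂) ≤ c₂ * r ^ 2 + c₁ * n * r + c₀ * n ^ 2 := by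
  rw [div_le_iff₀ (by positivity)]
  nlinarith [sq_nonneg (2 * c₂ * r + c₁ * n), mul_le_mul_of_nonneg_right hD (sq_nonneg n)]

/-- **The twist phase varies slowly**: with `P(r) = c₂r² + c₁nr + c₀n²` (`c₂ > 0`,
`4c₀c₂ − c₁² ≥ 1`), `N(r) = e₁n + e₂r`, `φ(r) = N(r)/(nP(r))`, for `n ≥ 1` and `|r| ≤ n`:
`|φ(r+1) − φ(r)| ≤ K/n³`, `K = 4c₂|e₂| + 16c₂²(|e₁|+|e₂|)(3c₂+|c₁|)`
(`P ≥ n²/(4c₂)`, `|N| ≤ (|e₁|+|e₂|)n`, `|P(r+1) − P(r)| ≤ (3c₂+|c₁|)n`). [folklore] -/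
theorem abs_twistPhaseG_succ_sub_le {c₀ c₁ c₂ e₁ e₂ n r : ℝ} (hc₂ : 0 < c₂)
    (hD : 1 ≤ 4 * c₀ * c₂ - c₁ ^ 2) (hn : 1 ≤ n) (hr : |r| ≤ n) :
    |(e₁ * n + e₂ * (r + 1)) / (n * (c₂ * (r + 1) ^ 2 + c₁ * n * (r + 1) + c₀ * n ^ 2)) -
        (e₁ * n + e₂ * r) / (n * (c₂ * r ^ 2 + c₁ * n * r + c₀ * n ^ 2))| ≤
      (4 * c₂ * |e₂| + 16 * c₂ ^ 2 * (|e₁| + |e₂|) * (3 * c₂ + |c₁|)) / n ^ 3 := by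
  set A := c₂ * r ^ 2 + c₁ * n * r + c₀ * n ^ 2 with hAdef
  set B := c₂ * (r + 1) ^ 2 + c₁ * n * (r + 1) + c₀ * n ^ 2 with hBdef
  set Nr := e₁ * n + e₂ * r with hNr
  have hn0 : 0 < n := by linarith
  have hL0 : 0 < n ^ 2 / (4 * c₂) := by positivity
  have hA : n ^ 2 / (4 * c₂) ≤ A := sq_div_le_slice hc₂ hD r
  have hB : n ^ 2 / (4 * c₂) ≤ B := sq_div_le_slice hc₂ hD (r + 1)
  have hA0 : 0 < A := lt_of_lt_of_le hL0 hA
  have hB0 : 0 < B := lt_of_lt_of_le hL0 hB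
  -- the difference over a common denominator
  have hdiff : (e₁ * n + e₂ * (r + 1)) / (n * B) - (e₁ * n + e₂ * r) / (n * A) =
      (e₂ * A - Nr * (B - A)) / (n * A * B) := by
    rw [hNr]
    field_simp
    ring
  have hnum : |e₂ * A - Nr * (B - A)| ≤ |e₂| * A + |Nr| * |B - A| := by
    calc |e₂ * A - Nr * (B - A)| ≤ |e₂ * A| + |Nr * (B - A)| := abs_sub _ _
      _ = |e₂| * A + |Nr| * |B - A| := by rw [abs_mul, abs_mul, abs_of_pos hA0]
  have hNrle : |Nr| ≤ (|e₁| + |e₂|) * n := by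
    rw [hNr]
    calc |e₁ * n + e₂ * r| ≤ |e₁ * n| + |e₂ * r| := abs_add_le _ _
      _ = |e₁| * n + |e₂| * |r| := by rw [abs_mul, abs_mul, abs_of_pos hn0]
      _ ≤ |e₁| * n + |e₂| * n := by gcongr
      _ = (|e₁| + |e₂|) * n := by ring
  have hBA : |B - A| ≤ (3 * c₂ + |c₁|) * n := by
    have e : B - A = c₂ * (2 * r + 1) + c₁ * n := by rw [hAdef, hBdef]; ring
    rw [e]
    have hr1 : |2 * r + 1| ≤ 3 * n := by
      have := abs_le.mp hr
      rw [abs_le]; constructor <;> linarith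
    calc |c₂ * (2 * r + 1) + c₁ * n| ≤ |c₂ * (2 * r + 1)| + |c₁ * n| := abs_add_le _ _
      _ = c₂ * |2 * r + 1| + |c₁| * n := by rw [abs_mul, abs_mul, abs_of_pos hc₂, abs_of_pos hn0]
      _ ≤ c₂ * (3 * n) + |c₁| * n := by gcongr
      _ = (3 * c₂ + |c₁|) * n := by ring
  rw [hdiff, abs_div, abs_of_pos (by positivity : 0 < n * A * B)]
  -- split into the two terms
  have hsplit : (|e₂| * A + |Nr| * |B - A|) / (n * A * B) =
      |e₂| / (n * B) + |Nr| * |B - A| / (n * A * B) := by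
    field_simp
  have hA' : n ^ 2 ≤ 4 * c₂ * A := by
    have := hA; rwa [div_le_iff₀ (by positivity), mul_comm] at this
  have hB' : n ^ 2 ≤ 4 * c₂ * B := by
    have := hB; rwa [div_le_iff₀ (by positivity), mul_comm] at this
  have h1 : |e₂| / (n * B) ≤ 4 * c₂ * |e₂| / n ^ 3 := by
    rw [div_le_div_iff₀ (by positivity) (by positivity)]
    calc |e₂| * n ^ 3 = (|e₂| * n) * n ^ 2 := by ring
      _ ≤ (|e₂| * n) * (4 * c₂ * B) := mul_le_mul_of_nonneg_left hB' (by positivity)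
      _ = 4 * c₂ * |e₂| * (n * B) := by ring
  have h2 : |Nr| * |B - A| / (n * A * B) ≤
      16 * c₂ ^ 2 * (|e₁| + |e₂|) * (3 * c₂ + |c₁|) / n ^ 3 := by
    have hnumer : |Nr| * |B - A| ≤ ((|e₁| + |e₂|) * n) * ((3 * c₂ + |c₁|) * n) :=
      mul_le_mul hNrle hBA (abs_nonneg _) (by positivity)
    calc |Nr| * |B - A| / (n * A * B) ≤ ((|e₁| + |e₂|) * n) * ((3 * c₂ + |c₁|) * n) / (n * A * B) :=
          div_le_div_of_nonneg_right hnumer (by positivity)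
      _ ≤ 16 * c₂ ^ 2 * (|e₁| + |e₂|) * (3 * c₂ + |c₁|) / n ^ 3 := by
          rw [div_le_div_iff₀ (by positivity) (by positivity)]
          have hAB : n ^ 2 * n ^ 2 ≤ (4 * c₂ * A) * (4 * c₂ * B) :=
            mul_le_mul hA' hB' (by positivity) (by positivity)
          calc (|e₁| + |e₂|) * n * ((3 * c₂ + |c₁|) * n) * n ^ 3
              = ((|e₁| + |e₂|) * (3 * c₂ + |c₁|) * n) * (n ^ 2 * n ^ 2) := by ring
            _ ≤ ((|e₁| + |e₂|) * (3 * c₂ + |c₁|) * n) * ((4 * c₂ * A) * (4 * c₂ * B)) :=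
                mul_le_mul_of_nonneg_left hAB (by positivity)
            _ = 16 * c₂ ^ 2 * (|e₁| + |e₂|) * (3 * c₂ + |c₁|) * (n * A * B) := by ring
  calc (|e₂ * A - Nr * (B - A)|) / (n * A * B) ≤ (|e₂| * A + |Nr| * |B - A|) / (n * A * B) :=
        div_le_div_of_nonneg_right hnum (by positivity)
    _ = |e₂| / (n * B) + |Nr| * |B - A| / (n * A * B) := hsplit
    _ ≤ 4 * c₂ * |e₂| / n ^ 3 + 16 * c₂ ^ 2 * (|e₁| + |e₂|) * (3 * c₂ + |c₁|) / n ^ 3 :=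
        add_le_add h1 h2
    _ = _ := by ring


section IntervalLemma


variable {ε C : ℝ}

/-- **Incomplete Kloosterman sum on an interval against monotone indicators and a slowly varying
weight.**  Let `hC` be the conclusion of Lemma 6 (exponent `ε`, constant `C`).  For `n ≥ 1`,
`Λ ≥ 1`, an interval `(r₁, r₂)` with `r₂ − r₁ < 2n`, predicates `P₁, P₂` each monotone or
antitone along the interval, and a weight `g` with `‖g‖ ≤ 1` and increments `≤ V` on it,
`‖∑_{r₁<r<r₂, (r,n)=1, r≡λ (Λ), P₁ r, P₂ r} e(h r̄/n) g(r)‖ ≤ C n^{1/2+ε} √(h,n) (3 + 2nV)`.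
[cite: IwaniecInventiones1978, §4 p. 180] -/
theorem norm_sum_Ioo_filter_hooley_mul_le
    (hC : ∀ (s Λ : ℕ) (h r₁ r₂ lam : ℤ), 1 ≤ s → 1 ≤ Λ → r₁ < r₂ → r₂ - r₁ < 2 * s →
      ‖∑ r ∈ (Finset.Ioo r₁ r₂).filter (fun r : ℤ => Int.gcd r s = 1 ∧ r ≡ lam [ZMOD Λ]),
          hooleyPhase h s r‖ ≤ C * (s : ℝ) ^ (1 / 2 + ε) * Real.sqrt (Int.gcd h s))
    {n Λ : ℕ} (hn : 1 ≤ n) (hΛ : 1 ≤ Λ) (h lam r₁ r₂ : ℤ) (hlen : r₂ - r₁ < 2 * n)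
    (P₁ P₂ : ℤ → Prop) [DecidablePred P₁] [DecidablePred P₂]
    (h₁ : (∀ r, r₁ < r → r + 1 < r₂ → P₁ r → P₁ (r + 1)) ∨
      (∀ r, r₁ < r → r + 1 < r₂ → P₁ (r + 1) → P₁ r))
    (h₂ : (∀ r, r₁ < r → r + 1 < r₂ → P₂ r → P₂ (r + 1)) ∨
      (∀ r, r₁ < r → r + 1 < r₂ → P₂ (r + 1) → P₂ r))
    (g : ℤ → ℂ) (hg : ∀ r, ‖g r‖ ≤ 1) {V : ℝ} (hV : 0 ≤ V)
    (hdg : ∀ r, r₁ < r → r + 1 < r₂ → ‖g (r + 1) - g r‖ ≤ V) :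
    ‖∑ r ∈ (Finset.Ioo r₁ r₂).filter (fun r : ℤ => Int.gcd r n = 1 ∧ r ≡ lam [ZMOD Λ] ∧
        P₁ r ∧ P₂ r), hooleyPhase h n r * g r‖ ≤
      C * (n : ℝ) ^ (1 / 2 + ε) * Real.sqrt (Int.gcd h n) * (3 + 2 * n * V) := by
  set M : ℝ := C * (n : ℝ) ^ (1 / 2 + ε) * Real.sqrt (Int.gcd h n) with hMdef
  have hM0 : 0 ≤ M := by
    have := hC n Λ h 0 1 lam hn hΛ zero_lt_one (by push_cast; omega)
    exact (norm_nonneg _).trans this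
  -- the empty case
  rcases le_or_gt r₂ (r₁ + 1) with hemp | hne
  · have : Finset.Ioo r₁ r₂ = ∅ := by
      ext x; simp only [Finset.mem_Ioo, Finset.notMem_empty, iff_false]; omega
    rw [this, Finset.filter_empty, Finset.sum_empty, norm_zero]
    have : 0 ≤ 3 + 2 * (n : ℝ) * V := by positivity
    positivity
  -- the index change `r = r₁ + 1 + i`, `i < N = r₂ - r₁ - 1`
  set N : ℕ := (r₂ - r₁ - 1).toNat with hN
  have hNeq : (N : ℤ) = r₂ - r₁ - 1 := Int.toNat_of_nonneg (by omega)
  set ρ : ℕ → ℤ := fun i => r₁ + 1 + i with hρ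
  have himage : ∀ k : ℕ, k ≤ N → Finset.Ioo r₁ (r₁ + 1 + k) = (Finset.range k).image ρ := by
    intro k _
    ext x
    simp only [Finset.mem_Ioo, Finset.mem_image, Finset.mem_range, hρ]
    constructor
    · rintro ⟨h0, hk⟩
      refine ⟨(x - r₁ - 1).toNat, ?_, ?_⟩
      · have : ((x - r₁ - 1).toNat : ℤ) = x - r₁ - 1 := Int.toNat_of_nonneg (by omega)
        omega
      · have : ((x - r₁ - 1).toNat : ℤ) = x - r₁ - 1 := Int.toNat_of_nonneg (by omega)
        omega
    · rintro ⟨i, hi, rfl⟩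
      constructor <;> omega
  have hinj : ∀ k : ℕ, Set.InjOn ρ (Finset.range k : Set ℕ) := by
    intro k i _ j _ hij
    simp only [hρ] at hij
    exact_mod_cast (add_left_cancel hij)
  -- the sequences
  set a : ℕ → ℂ := fun i => if Int.gcd (ρ i) n = 1 ∧ ρ i ≡ lam [ZMOD Λ] then hooleyPhase h n (ρ i)
    else 0 with hadef
  set w : ℕ → ℂ := fun i => g (ρ i) with hwdef
  set Q₁ : ℕ → Prop := fun i => P₁ (ρ i) with hQ₁
  set Q₂ : ℕ → Prop := fun i => P₂ (ρ i) with hQ₂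
  -- partial sums via Lemma 6
  have hpartial : ∀ k, k ≤ N → ‖∑ i ∈ Finset.range k, a i‖ ≤ M := by
    intro k hk
    have heq : ∑ i ∈ Finset.range k, a i =
        ∑ r ∈ (Finset.Ioo r₁ (r₁ + 1 + k)).filter
          (fun r : ℤ => Int.gcd r n = 1 ∧ r ≡ lam [ZMOD Λ]), hooleyPhase h n r := by
      rw [Finset.sum_filter, himage k hk, Finset.sum_image (hinj k)]
    rw [heq]
    have hk' : (k : ℤ) ≤ N := by exact_mod_cast hk
    exact hC n Λ h r₁ (r₁ + 1 + k) lam hn hΛ (by omega) (by omega)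
  -- rewrite the sum
  have hsum : ∑ r ∈ (Finset.Ioo r₁ r₂).filter (fun r : ℤ => Int.gcd r n = 1 ∧
        r ≡ lam [ZMOD Λ] ∧ P₁ r ∧ P₂ r), hooleyPhase h n r * g r =
      ∑ i ∈ Finset.range N,
        a i * ((if Q₁ i then (1 : ℂ) else 0) * (if Q₂ i then (1 : ℂ) else 0) * w i) := by
    have hr₂ : r₂ = r₁ + 1 + N := by omega
    rw [Finset.sum_filter, hr₂, himage N le_rfl, Finset.sum_image (hinj _)]
    refine Finset.sum_congr rfl fun i _ => ?_
    simp only [hadef, hwdef, hQ₁, hQ₂]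
    by_cases hc1 : Int.gcd (ρ i) n = 1 ∧ ρ i ≡ lam [ZMOD Λ]
    · by_cases hc2 : P₁ (ρ i)
      · by_cases hc3 : P₂ (ρ i)
        · rw [if_pos ⟨hc1.1, hc1.2, hc2, hc3⟩, if_pos hc1, if_pos hc2, if_pos hc3]; ring
        · rw [if_neg (fun h => hc3 h.2.2.2), if_neg hc3]; ring
      · rw [if_neg (fun h => hc2 h.2.2.1), if_neg hc2]; ring
    · rw [if_neg (fun h => hc1 ⟨h.1, h.2.1⟩), if_neg hc1]; ring
  rw [hsum]
  have hρsucc : ∀ i : ℕ, ρ (i + 1) = ρ i + 1 := fun i => by simp only [hρ]; push_cast; ring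
  have hρlt : ∀ i : ℕ, i + 1 < N → r₁ < ρ i ∧ ρ i + 1 < r₂ := by
    intro i hi
    have : (i : ℤ) + 1 < N := by exact_mod_cast hi
    simp only [hρ]
    constructor <;> omega
  have hmono₁ : (∀ i, i + 1 < N → Q₁ i → Q₁ (i + 1)) ∨ (∀ i, i + 1 < N → Q₁ (i + 1) → Q₁ i) := by
    rcases h₁ with h₁ | h₁
    · left; intro i hi hq
      simp only [hQ₁] at hq ⊢
      rw [hρsucc]; exact h₁ _ (hρlt i hi).1 (hρlt i hi).2 hq
    · right; intro i hi hq
      simp only [hQ₁] at hq ⊢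
      rw [hρsucc] at hq; exact h₁ _ (hρlt i hi).1 (hρlt i hi).2 hq
  have hmono₂ : (∀ i, i + 1 < N → Q₂ i → Q₂ (i + 1)) ∨ (∀ i, i + 1 < N → Q₂ (i + 1) → Q₂ i) := by
    rcases h₂ with h₂ | h₂
    · left; intro i hi hq
      simp only [hQ₂] at hq ⊢
      rw [hρsucc]; exact h₂ _ (hρlt i hi).1 (hρlt i hi).2 hq
    · right; intro i hi hq
      simp only [hQ₂] at hq ⊢
      rw [hρsucc] at hq; exact h₂ _ (hρlt i hi).1 (hρlt i hi).2 hq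
  have hcore := norm_sum_mul_indicator_mul_le (n := N) (a := a) (g := w) Q₁ Q₂ hM0 hpartial
    hmono₁ hmono₂ (fun i => by rw [hwdef]; exact hg _) hV
    (fun i hi => by
      rw [hwdef]; dsimp only
      rw [hρsucc]
      exact hdg _ (hρlt i hi).1 (hρlt i hi).2)
  refine hcore.trans (mul_le_mul_of_nonneg_left ?_ hM0)
  have hNle : (N : ℝ) ≤ 2 * n := by
    have : (N : ℤ) ≤ 2 * n := by omega
    exact_mod_cast this
  nlinarith


end IntervalLemma


open Literature.NumberTheory.Sieve.Vinogradov (norm_fourierChar)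


/-! ### The quadratic of a slice and its twist -/

/-- The quadratic `P(r) = c₂r² + c₁nr + c₀n²` of a slice (a positive definite form restricted to
one value `n` of the modulus variable). [folklore] -/
def quadP (c₀ c₁ c₂ : ℤ) (n : ℕ) (r : ℤ) : ℤ := c₂ * r ^ 2 + c₁ * n * r + c₀ * n ^ 2

/-- The twist `e(h (e₁n + e₂r)/(n P(r)))` of a slice. [cite: LemkeOliverActaArith2012, §3 p. 257] -/
def twistQ (h c₀ c₁ c₂ e₁ e₂ : ℤ) (n : ℕ) (r : ℤ) : ℂ :=
  (𝐞 ((h : ℝ) * (((e₁ * n + e₂ * r : ℤ)) : ℝ) / ((n : ℝ) * ((quadP c₀ c₁ c₂ n r : ℤ) : ℝ))) : ℂ)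

/-- The constant in the variation bound of the twist. [folklore] -/
def twistK (c₁ c₂ e₁ e₂ : ℤ) : ℝ :=
  4 * (c₂ : ℝ) * |(e₂ : ℝ)| + 16 * (c₂ : ℝ) ^ 2 * (|(e₁ : ℝ)| + |(e₂ : ℝ)|) * (3 * (c₂ : ℝ) + |(c₁ : ℝ)|)

/-- `twistK ≥ 0` for `c₂ ≥ 0`. [folklore] -/
theorem twistK_nonneg {c₁ c₂ e₁ e₂ : ℤ} (hc₂ : 0 ≤ c₂) : 0 ≤ twistK c₁ c₂ e₁ e₂ := by
  unfold twistK
  have : (0 : ℝ) ≤ c₂ := by exact_mod_cast hc₂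
  positivity

/-- `‖twistQ‖ = 1`. [folklore] -/
theorem norm_twistQ (h c₀ c₁ c₂ e₁ e₂ : ℤ) (n : ℕ) (r : ℤ) : ‖twistQ h c₀ c₁ c₂ e₁ e₂ n r‖ = 1 :=
  norm_fourierChar _

/-- **The twist of a slice varies slowly**: `‖g(r+1) − g(r)‖ ≤ 2π|h| K/n³` for `|r| ≤ n`, `n ≥ 1`
(`abs_twistPhaseG_succ_sub_le`). [folklore] -/
theorem norm_twistQ_succ_sub_le {c₀ c₁ c₂ : ℤ} (hc₂ : 0 < c₂) (hD : 1 ≤ 4 * c₀ * c₂ - c₁ ^ 2)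
    (h e₁ e₂ : ℤ) {n : ℕ} (hn : 1 ≤ n) {r : ℤ} (hr : |r| ≤ n) :
    ‖twistQ h c₀ c₁ c₂ e₁ e₂ n (r + 1) - twistQ h c₀ c₁ c₂ e₁ e₂ n r‖ ≤
      2 * Real.pi * |(h : ℝ)| * twistK c₁ c₂ e₁ e₂ / (n : ℝ) ^ 3 := by
  unfold twistQ
  refine (norm_fourierChar_sub_le _ _).trans ?_
  have hc₂' : (0 : ℝ) < c₂ := by exact_mod_cast hc₂
  have hD' : (1 : ℝ) ≤ 4 * (c₀ : ℝ) * c₂ - (c₁ : ℝ) ^ 2 := by exact_mod_cast hD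
  have hn' : (1 : ℝ) ≤ n := by exact_mod_cast hn
  have hr' : |(r : ℝ)| ≤ n := by
    rw [← Int.cast_abs]; exact_mod_cast hr
  have key := abs_twistPhaseG_succ_sub_le (e₁ := (e₁ : ℝ)) (e₂ := (e₂ : ℝ)) hc₂' hD' hn' hr'
  have heq : (h : ℝ) * (((e₁ * n + e₂ * (r + 1) : ℤ)) : ℝ) /
        ((n : ℝ) * ((quadP c₀ c₁ c₂ n (r + 1) : ℤ) : ℝ)) -
      (h : ℝ) * (((e₁ * n + e₂ * r : ℤ)) : ℝ) / ((n : ℝ) * ((quadP c₀ c₁ c₂ n r : ℤ) : ℝ)) =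
      (h : ℝ) * (((e₁ : ℝ) * n + e₂ * ((r : ℝ) + 1)) /
          (n * (c₂ * ((r : ℝ) + 1) ^ 2 + c₁ * n * ((r : ℝ) + 1) + c₀ * (n : ℝ) ^ 2)) -
        ((e₁ : ℝ) * n + e₂ * r) / (n * (c₂ * (r : ℝ) ^ 2 + c₁ * n * r + c₀ * (n : ℝ) ^ 2))) := by
    unfold quadP; push_cast; ring
  rw [heq, abs_mul]
  unfold twistK
  have hh : 0 ≤ |(h : ℝ)| := abs_nonneg _
  calc 2 * Real.pi * (|(h : ℝ)| * |((e₁ : ℝ) * n + e₂ * ((r : ℝ) + 1)) /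
          (n * (c₂ * ((r : ℝ) + 1) ^ 2 + c₁ * n * ((r : ℝ) + 1) + c₀ * (n : ℝ) ^ 2)) -
        ((e₁ : ℝ) * n + e₂ * r) / (n * (c₂ * (r : ℝ) ^ 2 + c₁ * n * r + c₀ * (n : ℝ) ^ 2))|)
      ≤ 2 * Real.pi * (|(h : ℝ)| * ((4 * c₂ * |(e₂ : ℝ)| +
          16 * (c₂ : ℝ) ^ 2 * (|(e₁ : ℝ)| + |(e₂ : ℝ)|) * (3 * c₂ + |(c₁ : ℝ)|)) / (n : ℝ) ^ 3)) := by
        gcongr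
    _ = _ := by ring

/-! ### Monotonicity of the slice quadratic on the two sides of its vertex -/

/-- The vertex index `w = −⌊(c₁n + c₂)/(2c₂)⌋`: `P(r+1) ≥ P(r)` iff `r ≥ w` (`c₂ > 0`). [folklore] -/
def vertexIdx (c₁ c₂ : ℤ) (n : ℕ) : ℤ := -((c₁ * n + c₂) / (2 * c₂))

/-- `P(r+1) − P(r) = c₂(2r+1) + c₁n`. [folklore] -/
theorem quadP_succ_sub (c₀ c₁ c₂ : ℤ) (n : ℕ) (r : ℤ) :
    quadP c₀ c₁ c₂ n (r + 1) - quadP c₀ c₁ c₂ n r = c₂ * (2 * r + 1) + c₁ * n := by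
  unfold quadP; ring

/-- Right of the vertex the slice quadratic is non-decreasing. [folklore] -/
theorem quadP_le_succ {c₀ c₁ c₂ : ℤ} (hc₂ : 0 < c₂) {n : ℕ} {r : ℤ} (hr : vertexIdx c₁ c₂ n ≤ r) :
    quadP c₀ c₁ c₂ n r ≤ quadP c₀ c₁ c₂ n (r + 1) := by
  have hd := quadP_succ_sub c₀ c₁ c₂ n r
  unfold vertexIdx at hr
  have h2 : 0 < 2 * c₂ := by linarith
  -- `-r ≤ (c₁ n + c₂)/(2c₂)` gives `-r * (2c₂) ≤ c₁ n + c₂`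
  have h3 : -r ≤ (c₁ * n + c₂) / (2 * c₂) := by omega
  have h4 : -r * (2 * c₂) ≤ c₁ * n + c₂ := (Int.le_ediv_iff_mul_le h2).1 h3
  linarith

/-- Left of the vertex the slice quadratic is decreasing. [folklore] -/
theorem quadP_succ_lt {c₀ c₁ c₂ : ℤ} (hc₂ : 0 < c₂) {n : ℕ} {r : ℤ} (hr : r < vertexIdx c₁ c₂ n) :
    quadP c₀ c₁ c₂ n (r + 1) < quadP c₀ c₁ c₂ n r := by
  have hd := quadP_succ_sub c₀ c₁ c₂ n r
  unfold vertexIdx at hr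
  have h2 : 0 < 2 * c₂ := by linarith
  have h3 : (c₁ * n + c₂) / (2 * c₂) < -r := by omega
  have h4 : c₁ * n + c₂ < (-r) * (2 * c₂) := by
    by_contra hle
    push Not at hle
    have := (Int.le_ediv_iff_mul_le h2).2 hle
    omega
  linarith

/-! ### The slice lemma -/

section Slice

variable {ε C : ℝ}

/-- **One monotone piece of a slice**: on `(r₁, r₂) ⊆ (−n, n)` lying on one side of the vertex,
with `r₂ − r₁ < 2n`, one residue class modulo `Λ`:
`‖∑ e(h' r̄/n) g(r)‖ ≤ C n^{1/2+ε} √(h',n) (3 + 4π|h|K/n²)`. [cite: IwaniecInventiones1978, §4 p. 180] -/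
theorem norm_piece_le
    (hC : ∀ (s Λ : ℕ) (h r₁ r₂ lam : ℤ), 1 ≤ s → 1 ≤ Λ → r₁ < r₂ → r₂ - r₁ < 2 * s →
      ‖∑ r ∈ (Finset.Ioo r₁ r₂).filter (fun r : ℤ => Int.gcd r s = 1 ∧ r ≡ lam [ZMOD Λ]),
          hooleyPhase h s r‖ ≤ C * (s : ℝ) ^ (1 / 2 + ε) * Real.sqrt (Int.gcd h s))
    {n Λ : ℕ} (hn : 1 ≤ n) (hΛ : 1 ≤ Λ) {c₀ c₁ c₂ : ℤ} (hc₂ : 0 < c₂)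
    (hD : 1 ≤ 4 * c₀ * c₂ - c₁ ^ 2) (h h' e₁ e₂ lam T₁ T₂ r₁ r₂ : ℤ)
    (hr₁ : -(n : ℤ) ≤ r₁) (hr₂ : r₂ ≤ n) (hlen : r₂ - r₁ < 2 * n)
    (hside : r₂ - 1 ≤ vertexIdx c₁ c₂ n ∨ vertexIdx c₁ c₂ n ≤ r₁ + 1) :
    ‖∑ r ∈ (Finset.Ioo r₁ r₂).filter (fun r : ℤ => Int.gcd r n = 1 ∧ r ≡ lam [ZMOD Λ] ∧
        T₁ < quadP c₀ c₁ c₂ n r ∧ quadP c₀ c₁ c₂ n r ≤ T₂),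
          hooleyPhase h' n r * twistQ h c₀ c₁ c₂ e₁ e₂ n r‖ ≤
      C * (n : ℝ) ^ (1 / 2 + ε) * Real.sqrt (Int.gcd h' n) *
        (3 + 4 * Real.pi * |(h : ℝ)| * twistK c₁ c₂ e₁ e₂ / (n : ℝ) ^ 2) := by
  have hn0 : (0 : ℝ) < n := by exact_mod_cast (by omega : 0 < n)
  set V : ℝ := 2 * Real.pi * |(h : ℝ)| * twistK c₁ c₂ e₁ e₂ / (n : ℝ) ^ 3 with hV
  have hV0 : 0 ≤ V := by
    rw [hV]; have := twistK_nonneg (c₁ := c₁) (e₁ := e₁) (e₂ := e₂) hc₂.le; positivity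
  have hmain := norm_sum_Ioo_filter_hooley_mul_le hC hn hΛ h' lam r₁ r₂ hlen
    (fun r => T₁ < quadP c₀ c₁ c₂ n r) (fun r => quadP c₀ c₁ c₂ n r ≤ T₂) ?_ ?_
    (twistQ h c₀ c₁ c₂ e₁ e₂ n) (fun r => (norm_twistQ _ _ _ _ _ _ _ _).le) hV0 ?_
  · refine hmain.trans (le_of_eq ?_)
    rw [hV]
    field_simp
    ring
  · -- monotonicity of `T₁ < P`
    rcases hside with hs | hs
    · right
      intro r _ hr2 hP
      have hrv : r < vertexIdx c₁ c₂ n := by omega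
      exact lt_trans hP (quadP_succ_lt hc₂ hrv)
    · left
      intro r hr1' _ hP
      have hrv : vertexIdx c₁ c₂ n ≤ r := by omega
      exact lt_of_lt_of_le hP (quadP_le_succ hc₂ hrv)
  · -- monotonicity of `P ≤ T₂`
    rcases hside with hs | hs
    · left
      intro r _ hr2 hP
      have hrv : r < vertexIdx c₁ c₂ n := by omega
      exact (quadP_succ_lt hc₂ hrv).le.trans hP
    · right
      intro r hr1' _ hP
      have hrv : vertexIdx c₁ c₂ n ≤ r := by omega
      exact (quadP_le_succ hc₂ hrv).trans hP
  · -- variation of the twist on `(r₁, r₂) ⊆ (−n, n)`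
    intro r hr1' hr2'
    have hr : |r| ≤ n := by rw [abs_le]; constructor <;> omega
    exact norm_twistQ_succ_sub_le hc₂ hD h e₁ e₂ hn hr

open scoped Classical in
/-- **The slice lemma.**  Fix the modulus `n ≥ 2`, a period `Λ ≥ 1`, a positive definite slice
quadratic `P` (`c₂ > 0`, `4c₀c₂ − c₁² ≥ 1`), the twist `g` of the slice, a side condition `per`
that is `Λ`-periodic on the integers prime to `n`, and an annulus `T₁ < P ≤ T₂`.  Then
`‖∑_{|r|<n, (r,n)=1, per r, T₁<P(r)≤T₂} e(h' r̄/n) g(r)‖ ≤ #{admissible classes mod Λ} · 3 · C n^{1/2+ε} √(h',n) (3 + 4π|h|K/n²)`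
(three monotone pieces: `(−n, m]`, `(m, M]`, `(M, n)` with `m = min(w, 0)`, `M = max(w, 0)`, `w`
the vertex clamped to `[−n, n−1]`). [cite: IwaniecInventiones1978, §4 p. 180] -/
theorem norm_sliceSum_le
    (hC : ∀ (s Λ : ℕ) (h r₁ r₂ lam : ℤ), 1 ≤ s → 1 ≤ Λ → r₁ < r₂ → r₂ - r₁ < 2 * s →
      ‖∑ r ∈ (Finset.Ioo r₁ r₂).filter (fun r : ℤ => Int.gcd r s = 1 ∧ r ≡ lam [ZMOD Λ]),
          hooleyPhase h s r‖ ≤ C * (s : ℝ) ^ (1 / 2 + ε) * Real.sqrt (Int.gcd h s))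
    {n Λ : ℕ} (hn : 2 ≤ n) (hΛ : 1 ≤ Λ) {c₀ c₁ c₂ : ℤ} (hc₂ : 0 < c₂)
    (hD : 1 ≤ 4 * c₀ * c₂ - c₁ ^ 2) (h h' e₁ e₂ T₁ T₂ : ℤ)
    (per : ℤ → Prop) [DecidablePred per]
    (hper : ∀ r r' : ℤ, r ≡ r' [ZMOD Λ] → Int.gcd r n = 1 → Int.gcd r' n = 1 → per r → per r') :
    ‖∑ r ∈ (Finset.Ioo (-(n : ℤ)) n).filter (fun r : ℤ => Int.gcd r n = 1 ∧ per r ∧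
        T₁ < quadP c₀ c₁ c₂ n r ∧ quadP c₀ c₁ c₂ n r ≤ T₂),
          hooleyPhase h' n r * twistQ h c₀ c₁ c₂ e₁ e₂ n r‖ ≤
      ((Finset.range Λ).filter (fun lam : ℕ =>
          ∃ r : ℤ, r ≡ (lam : ℤ) [ZMOD Λ] ∧ Int.gcd r n = 1 ∧ per r)).card *
        (3 * (C * (n : ℝ) ^ (1 / 2 + ε) * Real.sqrt (Int.gcd h' n) *
          (3 + 4 * Real.pi * |(h : ℝ)| * twistK c₁ c₂ e₁ e₂ / (n : ℝ) ^ 2))) := by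
  classical
  have hn1 : 1 ≤ n := by omega
  set B₁ : ℝ := C * (n : ℝ) ^ (1 / 2 + ε) * Real.sqrt (Int.gcd h' n) *
    (3 + 4 * Real.pi * |(h : ℝ)| * twistK c₁ c₂ e₁ e₂ / (n : ℝ) ^ 2) with hB₁
  have hM0 : 0 ≤ C * (n : ℝ) ^ (1 / 2 + ε) * Real.sqrt (Int.gcd h' n) := by
    have := hC n 1 h' 0 1 0 hn1 le_rfl zero_lt_one (by push_cast; omega)
    exact (norm_nonneg _).trans this
  have hB₁0 : 0 ≤ B₁ := by
    rw [hB₁]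
    have := twistK_nonneg (c₁ := c₁) (e₁ := e₁) (e₂ := e₂) hc₂.le
    positivity
  set F : ℤ → ℂ := fun r => hooleyPhase h' n r * twistQ h c₀ c₁ c₂ e₁ e₂ n r with hF
  set cond : ℤ → Prop := fun r => Int.gcd r n = 1 ∧ per r ∧
    T₁ < quadP c₀ c₁ c₂ n r ∧ quadP c₀ c₁ c₂ n r ≤ T₂ with hcond
  -- ### one class on one piece
  have hpiece : ∀ (lam r₁ r₂ : ℤ), -(n : ℤ) ≤ r₁ → r₂ ≤ n → r₂ - r₁ < 2 * n →
      (r₂ - 1 ≤ vertexIdx c₁ c₂ n ∨ vertexIdx c₁ c₂ n ≤ r₁ + 1) →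
      ‖∑ r ∈ (Finset.Ioo r₁ r₂).filter (fun r : ℤ => cond r ∧ r ≡ lam [ZMOD Λ]), F r‖ ≤
        (if ∃ r : ℤ, r ≡ lam [ZMOD Λ] ∧ Int.gcd r n = 1 ∧ per r then 1 else 0) * B₁ := by
    intro lam r₁ r₂ hr₁ hr₂ hlen hside
    by_cases hex : ∃ r : ℤ, r ≡ lam [ZMOD Λ] ∧ Int.gcd r n = 1 ∧ per r
    · rw [if_pos hex, one_mul]
      obtain ⟨r₀, hr₀, hg₀, hp₀⟩ := hex
      have hset : (Finset.Ioo r₁ r₂).filter (fun r : ℤ => cond r ∧ r ≡ lam [ZMOD Λ]) =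
          (Finset.Ioo r₁ r₂).filter (fun r : ℤ => Int.gcd r n = 1 ∧ r ≡ lam [ZMOD Λ] ∧
            T₁ < quadP c₀ c₁ c₂ n r ∧ quadP c₀ c₁ c₂ n r ≤ T₂) := by
        refine Finset.filter_congr fun r _ => ?_
        simp only [hcond]
        constructor
        · rintro ⟨⟨h1, -, h3, h4⟩, h5⟩; exact ⟨h1, h5, h3, h4⟩
        · rintro ⟨h1, h5, h3, h4⟩
          exact ⟨⟨h1, hper r₀ r (hr₀.trans h5.symm) hg₀ h1 hp₀, h3, h4⟩, h5⟩
      rw [hset, hF, hB₁]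
      exact norm_piece_le hC hn1 hΛ hc₂ hD h h' e₁ e₂ lam T₁ T₂ r₁ r₂ hr₁ hr₂ hlen hside
    · rw [if_neg hex, zero_mul]
      have hempty : (Finset.Ioo r₁ r₂).filter (fun r : ℤ => cond r ∧ r ≡ lam [ZMOD Λ]) = ∅ := by
        rw [Finset.filter_eq_empty_iff]
        rintro r - ⟨⟨h1, h2, -, -⟩, h5⟩
        exact hex ⟨r, h5, h1, h2⟩
      rw [hempty, Finset.sum_empty, norm_zero]
  -- ### the three pieces
  set w : ℤ := max (-(n : ℤ)) (min (vertexIdx c₁ c₂ n) (n - 1)) with hw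
  set m₁ : ℤ := min w 0 with hm₁
  set m₂ : ℤ := max w 0 with hm₂
  have hwlo : -(n : ℤ) ≤ w := le_max_left _ _
  have hwhi : w ≤ n - 1 := max_le (by omega) (min_le_right _ _)
  have hclass : ∀ lam : ℤ,
      ‖∑ r ∈ (Finset.Ioo (-(n : ℤ)) n).filter (fun r : ℤ => cond r ∧ r ≡ lam [ZMOD Λ]), F r‖ ≤
        (if ∃ r : ℤ, r ≡ lam [ZMOD Λ] ∧ Int.gcd r n = 1 ∧ per r then 1 else 0) * (3 * B₁) := by
    intro lam
    set S := (Finset.Ioo (-(n : ℤ)) n).filter (fun r : ℤ => cond r ∧ r ≡ lam [ZMOD Λ]) with hS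
    -- split `S` at `m₁` and `m₂`
    have hsplit : ∑ r ∈ S, F r =
        ∑ r ∈ S.filter (fun r => r ≤ m₁), F r +
          (∑ r ∈ (S.filter (fun r => ¬ r ≤ m₁)).filter (fun r => r ≤ m₂), F r +
            ∑ r ∈ (S.filter (fun r => ¬ r ≤ m₁)).filter (fun r => ¬ r ≤ m₂), F r) := by
      rw [← Finset.sum_filter_add_sum_filter_not S (fun r => r ≤ m₁),
        ← Finset.sum_filter_add_sum_filter_not (S.filter (fun r => ¬ r ≤ m₁)) (fun r => r ≤ m₂)]
    have hp1 : S.filter (fun r => r ≤ m₁) =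
        (Finset.Ioo (-(n : ℤ)) (m₁ + 1)).filter (fun r : ℤ => cond r ∧ r ≡ lam [ZMOD Λ]) := by
      ext r
      simp only [hS, Finset.mem_filter, Finset.mem_Ioo]
      constructor
      · rintro ⟨⟨⟨h1, h2⟩, h3⟩, h4⟩; exact ⟨⟨h1, by omega⟩, h3⟩
      · rintro ⟨⟨h1, h2⟩, h3⟩; exact ⟨⟨⟨h1, by omega⟩, h3⟩, by omega⟩
    have hp2 : (S.filter (fun r => ¬ r ≤ m₁)).filter (fun r => r ≤ m₂) =
        (Finset.Ioo m₁ (m₂ + 1)).filter (fun r : ℤ => cond r ∧ r ≡ lam [ZMOD Λ]) := by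
      ext r
      simp only [hS, Finset.mem_filter, Finset.mem_Ioo, not_le]
      constructor
      · rintro ⟨⟨⟨⟨h1, h2⟩, h3⟩, h4⟩, h5⟩; exact ⟨⟨h4, by omega⟩, h3⟩
      · rintro ⟨⟨h1, h2⟩, h3⟩; exact ⟨⟨⟨⟨by omega, by omega⟩, h3⟩, h1⟩, by omega⟩
    have hp3 : (S.filter (fun r => ¬ r ≤ m₁)).filter (fun r => ¬ r ≤ m₂) =
        (Finset.Ioo m₂ n).filter (fun r : ℤ => cond r ∧ r ≡ lam [ZMOD Λ]) := by
      ext r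
      simp only [hS, Finset.mem_filter, Finset.mem_Ioo, not_le]
      constructor
      · rintro ⟨⟨⟨⟨h1, h2⟩, h3⟩, h4⟩, h5⟩; exact ⟨⟨h5, h2⟩, h3⟩
      · rintro ⟨⟨h1, h2⟩, h3⟩; exact ⟨⟨⟨⟨by omega, h2⟩, h3⟩, by omega⟩, by omega⟩
    rw [hsplit, hp1, hp2, hp3]
    have hn2 : (2 : ℤ) ≤ n := by exact_mod_cast hn
    have e1 := hpiece lam (-(n : ℤ)) (m₁ + 1) le_rfl (by omega) (by omega) (by
      -- piece 1 lies left of the vertex (or is empty)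
      rcases lt_or_ge (vertexIdx c₁ c₂ n) (-(n : ℤ)) with hv | hv
      · right; omega
      · left; omega)
    have e2 := hpiece lam m₁ (m₂ + 1) (by omega) (by omega) (by omega) (by
      rcases le_or_gt w 0 with hw0 | hw0
      · right; omega
      · left; omega)
    have e3 := hpiece lam m₂ n (by omega) le_rfl (by omega) (by
      rcases le_or_gt (vertexIdx c₁ c₂ n) ((n : ℤ) - 1) with hv | hv
      · right; omega
      · left; omega)
    calc ‖_ + (_ + _)‖ ≤ ‖∑ r ∈ (Finset.Ioo (-(n : ℤ)) (m₁ + 1)).filter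
            (fun r : ℤ => cond r ∧ r ≡ lam [ZMOD Λ]), F r‖ +
          (‖∑ r ∈ (Finset.Ioo m₁ (m₂ + 1)).filter (fun r : ℤ => cond r ∧ r ≡ lam [ZMOD Λ]), F r‖ +
            ‖∑ r ∈ (Finset.Ioo m₂ n).filter (fun r : ℤ => cond r ∧ r ≡ lam [ZMOD Λ]), F r‖) :=
          (norm_add_le _ _).trans (add_le_add le_rfl (norm_add_le _ _))
      _ ≤ _ := by
          have := add_le_add e1 (add_le_add e2 e3)
          refine this.trans (le_of_eq ?_)
          ring
  -- ### sum over the classes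
  have hΛpos : (0 : ℤ) < (Λ : ℤ) := by exact_mod_cast (by omega : 0 < Λ)
  set S₀ := (Finset.Ioo (-(n : ℤ)) n).filter (fun r : ℤ => cond r) with hS₀
  have hmaps : ∀ r ∈ S₀, (r % (Λ : ℤ)).toNat ∈ Finset.range Λ := by
    intro r _
    rw [Finset.mem_range]
    have h0 : 0 ≤ r % (Λ : ℤ) := Int.emod_nonneg _ hΛpos.ne'
    have h1 : r % (Λ : ℤ) < Λ := Int.emod_lt_of_pos _ hΛpos
    exact (Int.toNat_lt h0).mpr h1
  rw [← Finset.sum_fiberwise_of_maps_to hmaps]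
  refine (norm_sum_le _ _).trans ?_
  have hfib : ∀ lam ∈ Finset.range Λ,
      ‖∑ r ∈ S₀.filter (fun r => (r % (Λ : ℤ)).toNat = lam), F r‖ ≤
        (if ∃ r : ℤ, r ≡ (lam : ℤ) [ZMOD Λ] ∧ Int.gcd r n = 1 ∧ per r then 1 else 0) * (3 * B₁) := by
    intro lam hlam
    rw [Finset.mem_range] at hlam
    have hclassiff : ∀ r : ℤ, (r % (Λ : ℤ)).toNat = lam ↔ r ≡ (lam : ℤ) [ZMOD (Λ : ℤ)] := by
      intro r
      have h0 : 0 ≤ r % (Λ : ℤ) := Int.emod_nonneg _ hΛpos.ne'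
      rw [Int.ModEq, Int.emod_eq_of_lt (by positivity : (0 : ℤ) ≤ lam) (by exact_mod_cast hlam)]
      constructor
      · intro h1
        have := Int.toNat_of_nonneg h0
        rw [h1] at this
        exact this.symm
      · intro h1
        rw [h1]; rfl
    have hfilter : S₀.filter (fun r => (r % (Λ : ℤ)).toNat = lam) =
        (Finset.Ioo (-(n : ℤ)) n).filter (fun r : ℤ => cond r ∧ r ≡ (lam : ℤ) [ZMOD Λ]) := by
      rw [hS₀, Finset.filter_filter]
      refine Finset.filter_congr fun r _ => ?_
      rw [hclassiff r]
    rw [hfilter]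
    exact hclass lam
  calc ∑ lam ∈ Finset.range Λ, ‖∑ r ∈ S₀.filter (fun r => (r % (Λ : ℤ)).toNat = lam), F r‖
      ≤ ∑ lam ∈ Finset.range Λ,
          (if ∃ r : ℤ, r ≡ (lam : ℤ) [ZMOD Λ] ∧ Int.gcd r n = 1 ∧ per r then 1 else 0) * (3 * B₁) :=
        Finset.sum_le_sum hfib
    _ = ∑ lam ∈ (Finset.range Λ).filter (fun lam : ℕ =>
          ∃ r : ℤ, r ≡ (lam : ℤ) [ZMOD Λ] ∧ Int.gcd r n = 1 ∧ per r), (3 * B₁) := by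
        rw [Finset.sum_filter]
        refine Finset.sum_congr rfl fun lam _ => ?_
        split_ifs <;> simp
    _ = _ := by rw [Finset.sum_const, nsmul_eq_mul]

end Slice


end Literature.NumberTheory.Sieve.Iwaniec1978

end
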